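import Mathlib
import Summits.NavierStokesRegularity.NavierStokesRegularity.Theorems.EulerZoomLiouvillePowerGaugeEulerLiouvilleCondenserWindowSummability
import Summits.NavierStokesRegularity.NavierStokesRegularity.Theorems.EulerZoomLiouvillePowerGaugeEulerLiouvilleCondenserWindowSummation

/-!
# THEOREM K^Σ′ (master form) and THEOREM K^Σ, UNCONDITIONAL — the closers (nsreg-p2 g37 ROUND-47 v1.3 §5b; plates t50-KΣ′
`NsregP2.R47.WindowSummabilityLiouville`, t50-KΣ `NsregP2.R47.SummabilityLiouville`, texts `r47/Sketch47.lean` f89f412bf4150db7 VERBATIM)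

Width piece for crux `EulerZoomLiouville.PowerGaugeEulerLiouville` (stmt-NavierStokesRegularity-19832), by name under LEAD 19832
(ns-typeII-p2 g14); seat ns-sfl-p1 g7 (K∞/K^Σ assembler), `--supports stmt-NavierStokesRegularity-19832 --as helper`.

`Condenser.windowSummabilityLiouville_of` / `Condenser.summabilityLiouville_of` (`…CondenserWindowSummability`, this seat) take the
two S-plates (W4′) `WeightedWindowBudget` and (W4) `WindowSummation` as hypotheses; ns-ezl-w2 g5's `Condenser.weightedWindowBudget`
and `Condenser.windowSummation` (`…CondenserWindowSummation`) ARE those texts, so the two theorems below are the Sketch47 Props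
VERBATIM and unconditional:

* `windowSummabilityLiouville` — for ANY `q > 1` and ANY pairwise disjoint windows `[ℓ_k, qℓ_k)` with envelopes `‖DV‖ ≤ exp(G_k)` on
  `B(0,qℓ_k)` (`G_k ≥ 1`): `Σ_k ℓ_k^{2+ρ}/G_k = ∞` ⇒ an exactly self-similar `C²` member of the crux class is trivial — the CEILING
  of the capacity method (it contains K′, K″, K∞ and the LEAD's T3 `…CondenserInfiniteType`);
* `summabilityLiouville` — the geometric family: `‖DV‖ ≤ exp(G(R))` on `B(0,R)` for `R ≥ R₀` and `Σ_k (qᵏR₀)^{2+ρ}/G(q^{k+1}R₀) = ∞`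
  ⇒ trivial (`G = R^{2+ρ}log R`, `R^{2+ρ} log R log log R` excluded; `R^{2+ρ}(log R)^{1+ε}` not).

HONEST FRAMING: stratum statements about HYPOTHETICAL exactly self-similar `C²` members of crux E's class (MODEL lattice); nothing
here proves the crux E (19832 OPEN), any door Target, or Navier–Stokes regularity. [nsreg-p2 ROUND-47 v1.3 THEOREMS K^Σ′/K^Σ;
cite: ConstantinIgnatovaVicol2026Putative, §3.4.1; folklore (length–area method)]
-/

noncomputable section

open Set Filter Topology Metric Function MeasureTheory Real
open scoped RealInnerProductSpace NNReal ENNReal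

set_option linter.dupNamespace false

namespace Summit.NavierStokesRegularity.NavierStokesRegularity.Theorems.PowerGaugeEulerLiouville.Condenser

open Literature.Analysis Literature.Analysis.FluidPDE
open Summit.NavierStokesRegularity.NavierStokesRegularity.Theorems.PowerGaugeEulerLiouville

/-- **(K^Σ′) `NsregP2.R47.WindowSummabilityLiouville`, binder-for-binder, UNCONDITIONAL** (Sketch47 v1.3, sha16 f89f412bf4150db7;
`E3` spelled out). [nsreg-p2 ROUND-47 v1.3 THEOREM K^Σ′; cite: ConstantinIgnatovaVicol2026Putative, §3.4.1; folklore] -/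
theorem windowSummabilityLiouville :
    ∀ (ρ : ℝ), 0 < ρ → ρ ≤ 1 / 2 →
      ∀ (u : ℝ → EuclideanSpace ℝ (Fin 3) → EuclideanSpace ℝ (Fin 3)) (p : ℝ → EuclideanSpace ℝ (Fin 3) → ℝ)
        (H : ℝ → EuclideanSpace ℝ (Fin 3) → EuclideanSpace ℝ (Fin 3) →L[ℝ] EuclideanSpace ℝ (Fin 3)) (c : ℝ≥0), 0 < (c : ℝ) →
        IsSuitableWeakSolutionOn (slab (EuclideanSpace ℝ (Fin 3)) (Iio 0) isOpen_Iio) 0 0 u p →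
        HasWeakSpatialGradientOn (slab (EuclideanSpace ℝ (Fin 3)) (Iio 0) isOpen_Iio) u H →
        (∀ a : ℝ, 0 < a →
          ENNReal.ofReal (a ^ (2 * ρ)) * cknA a (0 : ℝ × EuclideanSpace ℝ (Fin 3)) u +
              ENNReal.ofReal (a ^ ρ) * cknE a (0 : ℝ × EuclideanSpace ℝ (Fin 3)) H +
            ENNReal.ofReal (a ^ (2 * ρ)) * cknD a (0 : ℝ × EuclideanSpace ℝ (Fin 3)) p ≤ (c : ℝ≥0∞)) →
        ∀ (V : EuclideanSpace ℝ (Fin 3) → EuclideanSpace ℝ (Fin 3)) (P : EuclideanSpace ℝ (Fin 3) → ℝ),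
          (∀ τ : ℝ, τ < 0 → u τ = selfSimilarCollapse (1 / (2 + ρ)) 0 V τ) →
          (∀ τ : ℝ, τ < 0 → p τ = selfSimilarCollapsePressure (1 / (2 + ρ)) 0 P τ) →
          ContDiff ℝ 2 V →
          ∀ (q : ℝ) (ℓ G : ℕ → ℝ), 1 < q → (∀ k : ℕ, 0 < ℓ k) → (∀ k : ℕ, q * ℓ k ≤ ℓ (k + 1)) → (∀ k : ℕ, 1 ≤ G k) →
            (∀ k : ℕ, ∀ z ∈ ball (0 : EuclideanSpace ℝ (Fin 3)) (q * ℓ k), ‖fderiv ℝ V z‖ ≤ Real.exp (G k)) →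
            ¬ Summable (fun k : ℕ => ℓ k ^ (2 + ρ) / G k) →
          uncurry u =ᵐ[volume.restrict (Iio (0 : ℝ) ×ˢ (univ : Set (EuclideanSpace ℝ (Fin 3))))] 0 :=
  windowSummabilityLiouville_of weightedWindowBudget windowSummation

/-- **(K^Σ) `NsregP2.R47.SummabilityLiouville`, binder-for-binder, UNCONDITIONAL** (Sketch47 v1.2/v1.3; `E3` spelled out).
[nsreg-p2 ROUND-47 v1.2 THEOREM K^Σ; cite: ConstantinIgnatovaVicol2026Putative, §3.4.1; folklore] -/
theorem summabilityLiouville :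
    ∀ (ρ : ℝ), 0 < ρ → ρ ≤ 1 / 2 →
      ∀ (u : ℝ → EuclideanSpace ℝ (Fin 3) → EuclideanSpace ℝ (Fin 3)) (p : ℝ → EuclideanSpace ℝ (Fin 3) → ℝ)
        (H : ℝ → EuclideanSpace ℝ (Fin 3) → EuclideanSpace ℝ (Fin 3) →L[ℝ] EuclideanSpace ℝ (Fin 3)) (c : ℝ≥0), 0 < (c : ℝ) →
        IsSuitableWeakSolutionOn (slab (EuclideanSpace ℝ (Fin 3)) (Iio 0) isOpen_Iio) 0 0 u p →
        HasWeakSpatialGradientOn (slab (EuclideanSpace ℝ (Fin 3)) (Iio 0) isOpen_Iio) u H →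
        (∀ a : ℝ, 0 < a →
          ENNReal.ofReal (a ^ (2 * ρ)) * cknA a (0 : ℝ × EuclideanSpace ℝ (Fin 3)) u +
              ENNReal.ofReal (a ^ ρ) * cknE a (0 : ℝ × EuclideanSpace ℝ (Fin 3)) H +
            ENNReal.ofReal (a ^ (2 * ρ)) * cknD a (0 : ℝ × EuclideanSpace ℝ (Fin 3)) p ≤ (c : ℝ≥0∞)) →
        ∀ (V : EuclideanSpace ℝ (Fin 3) → EuclideanSpace ℝ (Fin 3)) (P : EuclideanSpace ℝ (Fin 3) → ℝ),
          (∀ τ : ℝ, τ < 0 → u τ = selfSimilarCollapse (1 / (2 + ρ)) 0 V τ) →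
          (∀ τ : ℝ, τ < 0 → p τ = selfSimilarCollapsePressure (1 / (2 + ρ)) 0 P τ) →
          ContDiff ℝ 2 V →
          ∀ (G : ℝ → ℝ) (q R₀ : ℝ), 1 < q → 0 < R₀ → (∀ R : ℝ, R₀ ≤ R → 1 ≤ G R) →
            (∀ R : ℝ, R₀ ≤ R → ∀ z ∈ ball (0 : EuclideanSpace ℝ (Fin 3)) R, ‖fderiv ℝ V z‖ ≤ Real.exp (G R)) →
            ¬ Summable (fun k : ℕ => (q ^ k * R₀) ^ (2 + ρ) / G (q ^ (k + 1) * R₀)) →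
          uncurry u =ᵐ[volume.restrict (Iio (0 : ℝ) ×ˢ (univ : Set (EuclideanSpace ℝ (Fin 3))))] 0 :=
  summabilityLiouville_of weightedWindowBudget windowSummation

end Summit.NavierStokesRegularity.NavierStokesRegularity.Theorems.PowerGaugeEulerLiouville.Condenser

end
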